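import Mathlib.LinearAlgebra.Lagrange
import Mathlib.Analysis.Complex.Basic
import Mathlib.LinearAlgebra.Matrix.Determinant.Basic
import Mathlib.GroupTheory.Perm.Sign
import HarnessLib

/-!
# SliceSignRank — crux `PositiveSliceNormalForm` (stmt-ValiantsHypothesis-15119), line `birth`:
# stub `stub_realDescent` (real descent of permutation-product sums)

Route `ValiantsHypothesis/SliceSignRank`, crux `PositiveSliceNormalForm`, registered line
`Cruxes/PositiveSliceNormalForm/Lines/birth.lean` (stubs `stub_detSliceComplexNF` — the transfer
conjecture, untouched — and the present normalisation). This file proves, verbatim: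

* `stub_realDescent` — if a REAL function `a` on `S_n` (`n ≥ 1`) satisfies
  `a σ = sgn σ · Σ_{t<k} Π_i Z_t(σ i, i)` for complex matrices `Z_t`, then
  `a σ = sgn σ · Σ_{t<k(n+1)} Π_i W_t(σ i, i)` for REAL matrices `W_t`.

Proof (Lagrange interpolation in the imaginary unit): write `Z = A + iB`; the polynomial
`P(X) = Π_i (A(σ i, i) + X·B(σ i, i))` has degree `≤ n`, real values at real nodes and `P(i) = Π_i Z(σ i,i)`;
interpolating at the nodes `0, 1, …, n` (Mathlib `Lagrange.eq_interpolate`) gives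
`Π_i Z(σ i, i) = Σ_m c_m · Π_i (A + m B)(σ i, i)` with complex weights `c_m = ℓ_m(i)` that do NOT depend
on `σ` or `t` (`prod_re_add_I_mul_im_eq_sum`); since `a` is real one may take real parts, and the real
scalar `Re c_m` is absorbed into column `0` of the real matrix `A + m B` (each column index occurs
exactly once in `Π_i W(σ i, i)`; this is where `n ≥ 1` is used); reindex `Fin k × Fin (n+1) ≃ Fin (k(n+1))`.

Honest framing: a normalisation stub; the crux's content (`stub_detSliceComplexNF`, the transfer
conjecture) is untouched and the crux stays OPEN — and HELD (route SliceSignRank rev 3: it is a derived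
parent of `SrkNotQP` / `PositiveSliceSignTransfer`; a direct proof is welcome at low priority);
VP ≠ VNP is NOT proved here.
-/

noncomputable section

open Polynomial

-- the summit and the problem share the name `ValiantsHypothesis` (D-0017 single-conjunct layout)
set_option linter.dupNamespace false

namespace Summit.ValiantsHypothesis.ValiantsHypothesis.Theorems.SliceSignRank.PositiveSliceNormalForm

/-- **Lagrange interpolation in the imaginary unit.** For every `n` there are real nodes `s_m` and
complex weights `c_m` (`m ≤ n`) such that for ALL real vectors `A, B ∈ ℝ^n`:
`Π_i (A_i + i·B_i) = Σ_m c_m · Π_i (A_i + s_m B_i)` — the polynomial `Π_i (A_i + X B_i)` has degree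
`≤ n`, so it is its Lagrange interpolant at `n + 1` nodes, evaluated at `X = i`. [folklore] -/
theorem prod_re_add_I_mul_im_eq_sum (n : ℕ) :
    ∃ (s : Fin (n + 1) → ℝ) (c : Fin (n + 1) → ℂ), ∀ (A B : Fin n → ℝ),
      ∏ i, ((A i : ℂ) + Complex.I * (B i : ℂ)) =
        ∑ m, c m * ((∏ i, (A i + s m * B i) : ℝ) : ℂ) := by
  classical
  -- nodes `0, 1, …, n` and weights `ℓ_m(i)`
  let v : Fin (n + 1) → ℂ := fun m => (m : ℂ)
  have hv : Set.InjOn v ↑(Finset.univ : Finset (Fin (n + 1))) := by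
    intro a _ b _ hab
    have : ((a : ℕ) : ℂ) = ((b : ℕ) : ℂ) := hab
    exact Fin.ext (by exact_mod_cast this)
  refine ⟨fun m => (m : ℝ), fun m => eval Complex.I (Lagrange.basis Finset.univ v m), fun A B => ?_⟩
  -- the polynomial `Π_i (A_i + X B_i)`
  let f : ℂ[X] := ∏ i, (C (A i : ℂ) + X * C (B i : ℂ))
  have hdeg : f.degree < ↑(Finset.univ : Finset (Fin (n + 1))).card := by
    rw [Finset.card_univ, Fintype.card_fin]
    have hnat : f.natDegree ≤ n := by
      have hfac : ∀ i : Fin n, (C (A i : ℂ) + X * C (B i : ℂ)).natDegree ≤ 1 := fun i => by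
        refine (natDegree_add_le _ _).trans (max_le (by simp) ?_)
        exact natDegree_mul_le.trans (by simp)
      calc f.natDegree ≤ ∑ i : Fin n, (C (A i : ℂ) + X * C (B i : ℂ)).natDegree :=
            natDegree_prod_le _ _
        _ ≤ ∑ _i : Fin n, (1 : ℕ) :=
            Finset.sum_le_sum (f := fun i => (C (A i : ℂ) + X * C (B i : ℂ)).natDegree)
              (g := fun _ => 1) fun i _ => hfac i
        _ = n := by simp
    exact lt_of_le_of_lt (degree_le_of_natDegree_le hnat) (by exact_mod_cast Nat.lt_succ_self n)
  have hf := Lagrange.eq_interpolate hv hdeg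
  -- evaluate the interpolation identity at `X = i`
  have hevI : eval Complex.I f = ∏ i, ((A i : ℂ) + Complex.I * (B i : ℂ)) := by
    simp only [f, eval_prod, eval_add, eval_C, eval_mul, eval_X, mul_comm Complex.I]
  have hevR : ∀ m : Fin (n + 1), eval (v m) f = ((∏ i, (A i + (m : ℝ) * B i) : ℝ) : ℂ) := by
    intro m
    simp only [f, v, eval_prod, eval_add, eval_C, eval_mul, eval_X, Complex.ofReal_prod]
    refine Finset.prod_congr rfl fun i _ => ?_
    rw [Complex.ofReal_add, Complex.ofReal_mul, Complex.ofReal_natCast, mul_comm]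
  rw [← hevI, hf, Lagrange.interpolate_apply, eval_finsetSum]
  refine Finset.sum_congr rfl fun m _ => ?_
  rw [eval_mul, eval_C, hevR m, mul_comm]

/-- Scaling column `0` scales every permutation product once (`n ≥ 1`). [folklore] -/
theorem prod_perm_scaleCol (n : ℕ) (hn : 1 ≤ n) (M W : Matrix (Fin n) (Fin n) ℝ) (r : ℝ)
    (hW : ∀ p q, W p q = if q = ⟨0, hn⟩ then r * M p q else M p q) (σ : Equiv.Perm (Fin n)) :
    ∏ i, W (σ i) i = r * ∏ i, M (σ i) i := by
  classical
  rw [← Finset.mul_prod_erase Finset.univ _ (Finset.mem_univ (⟨0, hn⟩ : Fin n)),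
    ← Finset.mul_prod_erase Finset.univ (fun i => M (σ i) i) (Finset.mem_univ (⟨0, hn⟩ : Fin n)),
    hW, if_pos rfl, mul_assoc]
  congr 2
  exact Finset.prod_congr rfl fun i hi => by rw [hW, if_neg (Finset.ne_of_mem_erase hi)]

/-- **Stub `RealDescent`** (registered obligation `stub_realDescent` of crux `PositiveSliceNormalForm`,
line `birth`; signature verbatim): a real function on `S_n` (`n ≥ 1`) which is `sgn σ` times a sum of
`k` complex permutation products `Π_i Z_t(σ i, i)` is `sgn σ` times a sum of `k(n+1)` REAL permutation
products (Lagrange interpolation at `n+1` real nodes in the imaginary unit, real parts, the weight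
absorbed into column `0`). [folklore] -/
theorem stub_realDescent :
    ∀ (n k : ℕ), 1 ≤ n → ∀ (Z : Fin k → Matrix (Fin n) (Fin n) ℂ) (a : Equiv.Perm (Fin n) → ℝ),
      (∀ σ : Equiv.Perm (Fin n),
          (a σ : ℂ) = ((Equiv.Perm.sign σ : ℤ) : ℂ) * ∑ t, ∏ i, Z t (σ i) i) →
      ∃ W : Fin (k * (n + 1)) → Matrix (Fin n) (Fin n) ℝ, ∀ σ : Equiv.Perm (Fin n),
        (a σ : ℂ) = ((Equiv.Perm.sign σ : ℤ) : ℂ) * ∑ t, ∏ i, ((W t (σ i) i : ℝ) : ℂ) := by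
  intro n k hn Z a ha
  classical
  obtain ⟨s, c, hsc⟩ := prod_re_add_I_mul_im_eq_sum n
  -- the real matrices `A_t + s_m B_t`, and the same with column `0` scaled by `Re c_m`
  obtain ⟨M, hM⟩ : ∃ M : Fin k → Fin (n + 1) → Matrix (Fin n) (Fin n) ℝ,
      ∀ t m p q, M t m p q = (Z t p q).re + s m * (Z t p q).im := ⟨_, fun _ _ _ _ => rfl⟩
  obtain ⟨W, hW⟩ : ∃ W : Fin k → Fin (n + 1) → Matrix (Fin n) (Fin n) ℝ,
      ∀ t m p q, W t m p q = if q = ⟨0, hn⟩ then (c m).re * M t m p q else M t m p q :=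
    ⟨fun t m p q => if q = ⟨0, hn⟩ then (c m).re * M t m p q else M t m p q, fun _ _ _ _ => rfl⟩
  refine ⟨fun j => W (finProdFinEquiv.symm j).1 (finProdFinEquiv.symm j).2, fun σ => ?_⟩
  -- each complex product is a weighted sum of real products
  have hZ : ∀ t, ∏ i, Z t (σ i) i = ∑ m, c m * ((∏ i, M t m (σ i) i : ℝ) : ℂ) := by
    intro t
    have h := hsc (fun i => (Z t (σ i) i).re) (fun i => (Z t (σ i) i).im)
    have hl : ∏ i, (((Z t (σ i) i).re : ℂ) + Complex.I * ((Z t (σ i) i).im : ℂ)) =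
        ∏ i, Z t (σ i) i :=
      Finset.prod_congr rfl fun i _ => by rw [mul_comm]; exact Complex.re_add_im _
    rw [← hl, h]
    refine Finset.sum_congr rfl fun m _ => ?_
    congr 2
    exact Finset.prod_congr rfl fun i _ => (hM t m (σ i) i).symm
  -- take real parts (`a σ` is real)
  have hreal : a σ = (Equiv.Perm.sign σ : ℤ) * ∑ t, ∑ m, (c m).re * ∏ i, M t m (σ i) i := by
    have h1 := ha σ
    simp_rw [hZ] at h1
    have h2 := congr_arg Complex.re h1
    simp only [Complex.ofReal_re, Complex.mul_re, Complex.re_sum, Complex.im_sum, Complex.ofReal_im,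
      Complex.intCast_re, Complex.intCast_im, mul_zero, sub_zero, zero_mul] at h2
    exact h2
  -- absorb the weights and reindex
  have hWp : ∀ t m, ∏ i, W t m (σ i) i = (c m).re * ∏ i, M t m (σ i) i := fun t m =>
    prod_perm_scaleCol n hn (M t m) (W t m) (c m).re (hW t m) σ
  rw [hreal]
  push_cast
  congr 1
  rw [← Fintype.sum_prod_type']
  refine Fintype.sum_equiv finProdFinEquiv _ _ fun x => ?_
  have h3 := congr_arg (fun r : ℝ => (r : ℂ)) (hWp x.1 x.2)
  push_cast at h3
  rw [Equiv.symm_apply_apply, h3]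

end Summit.ValiantsHypothesis.ValiantsHypothesis.Theorems.SliceSignRank.PositiveSliceNormalForm

end
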